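import Summits.CriticalPhenomena.Ising3DConformalLimit.Theorems.PerfectScreeningSubharmonicOffOriginBetheThreshold
import HarnessLib

/-!
# The DLR (heat-bath) form of the lattice Laplacian of Ising correlations: an exact odd-moment expansion
# (crux `SubharmonicOffOrigin`, stmt-CriticalPhenomena-1341, route PerfectScreening; by-product)

For the nearest-neighbour Ising model on ANY locally finite graph `G`, a finite volume `Λ ∋ x`, `+`
boundary condition, zero field, any real `β` and any site `o ≠ x` (`N = N(x)` the neighbours of `x`,
`n = deg x`, `h_x = Σ_{y∈N} σ_y`, `t = tanh β`):

`Σ_{y∼x} ⟨σ_oσ_y⟩⁺_Λ − n·⟨σ_oσ_x⟩⁺_Λ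
   = cosh^n β · Σ_{T ⊆ N, #T odd} t^{#T−1}(1−t)(#T − (n−#T)t) · ⟨σ_o σ_T / cosh(β h_x)⟩⁺_Λ`

(`finiteVolume_laplacian_dlr`).  The observables `σ_oσ_T/cosh(βh_x)` do not read `σ_x`; their
expectations are `2/Z` times the unnormalised moments of the x-DELETED system (the Boltzmann factor of
the edges not touching `x`), which are nonnegative for `β ≥ 0` by the first Griffiths inequality
(`Bethe.deleted_outer_gks_nonneg`).  So the lattice Laplacian of the two-point function at `x` is an
explicit combination of 1-, 3-, 5-, … spin insertions at the neighbours of `x`, with coefficients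
`c_k(t) = t^{k−1}(1−t)(k − (n−k)t)`: all `≥ 0` up to the Bethe threshold `(n−1)t ≤ 1` (whence
`Bethe.finiteVolume_bethe`), and on `ℤ³` at `β_c` (`n = 6`, `t = 0.2181 > 1/5`) exactly `c_1 < 0`:
subharmonicity at `x` ⟺ `(5t−1)(1−t)·S₁ ≤ 3t²(1−t)²·S₃ + t⁴(1−t)(5−t)·S₅` with
`S_k = Σ_{#T=k} ⟨σ₀σ_T/cosh βh_x⟩⁺` — the "x-deleted odd-moment dominance" door of
`Cruxes/SubharmonicOffOrigin/STRATEGY-CENSUS.md` §S4, now an identity in the tree.  (This is the DLR /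
Callen form `⟨σ₀·(h_x − 6 tanh βh_x)⟩` of the crux card, resolved into Griffiths-positive pieces.)

Proof: two-step decomposition of the Boltzmann sums at `x` (Friedli–Velenik 2017 Lemma 6.7, tree
`sum_isingWeight_fixed_eq_sum_sum` with `Λ' = {x}`): for an observable `F` not reading `σ_x`,
`Z⟨F⟩ = 2ΣE·F·cosh(βh_x)` and `Z⟨σ_x F⟩ = 2ΣE·F·sinh(βh_x)`; then the abstract identity
`Bethe.bethe_identity` (finite high-temperature expansion, Friedli–Velenik 2017 eq. (3.44)).

References: S. Friedli, Y. Velenik, *Statistical Mechanics of Lattice Systems* (CUP 2017), Lemma 6.7,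
eq. (3.44) [FriedliVelenik2017]; H. B. Callen, Phys. Lett. 4 (1963) 161.  Helpers of
stmt-CriticalPhenomena-1341 (`--supports`); no definition, no named fact.
-/

noncomputable section

open MeasureTheory Finset
open Literature.Probability.LatticeModels
open scoped symmDiff

namespace Summit.CriticalPhenomena.Ising3DConformalLimit.Theorems.PerfectScreening.Bethe

variable {V : Type*} [DecidableEq V] (G : SimpleGraph V) [G.LocallyFinite]

/-- **Two-step decomposition at `x` for an observable not reading `σ_x`** (Friedli–Velenik 2017,
Lemma 6.7): `Σ_τ w⁺_Λ(τ) F = Σ_{τ₂} E(τ₂) · F · 2cosh(β h_x)` and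
`Σ_τ w⁺_Λ(τ) σ_x F = Σ_{τ₂} E(τ₂) · F · 2sinh(β h_x)`, where `τ₂` runs over the configurations of
`Λ ∖ {x}` glued with `+` outside and `E` is the Boltzmann factor of the edges not touching `x`. -/
theorem two_step_at {β : ℝ} {Λ : Finset V} {x : V} (hx : x ∈ Λ) {F : SpinConfig V → ℝ}
    (hF : ∀ σ u, F (Function.update σ x u) = F σ) :
    (∑ τ : Λ → ℤˣ, isingWeight G Λ β 0 .plus τ * F (glue Λ τ .plus) =
      ∑ τ₂ : ↥(Λ \ {x}) → ℤˣ,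
        Real.exp (β * (∑ e ∈ edgesTouching G Λ \ edgesTouching G {x},
            bondSpin (glue (Λ \ {x}) τ₂ (.fixed 1)) e +
          0 * ∑ z ∈ Λ \ {x}, spinAt z (glue (Λ \ {x}) τ₂ (.fixed 1)))) *
        (F (glue (Λ \ {x}) τ₂ (.fixed 1)) *
          (2 * Real.cosh (β * ∑ y ∈ G.neighborFinset x, spinAt y (glue (Λ \ {x}) τ₂ (.fixed 1)))))) ∧
    (∑ τ : Λ → ℤˣ, isingWeight G Λ β 0 .plus τ * (spinAt x (glue Λ τ .plus) * F (glue Λ τ .plus)) =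
      ∑ τ₂ : ↥(Λ \ {x}) → ℤˣ,
        Real.exp (β * (∑ e ∈ edgesTouching G Λ \ edgesTouching G {x},
            bondSpin (glue (Λ \ {x}) τ₂ (.fixed 1)) e +
          0 * ∑ z ∈ Λ \ {x}, spinAt z (glue (Λ \ {x}) τ₂ (.fixed 1)))) *
        (F (glue (Λ \ {x}) τ₂ (.fixed 1)) *
          (2 * Real.sinh (β * ∑ y ∈ G.neighborFinset x, spinAt y (glue (Λ \ {x}) τ₂ (.fixed 1)))))) := by
  classical
  have hplus : (BoundaryCondition.plus : BoundaryCondition V) = .fixed 1 := rfl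
  have hsub : ({x} : Finset V) ⊆ Λ := Finset.singleton_subset_iff.2 hx
  have hxmem : x ∈ ({x} : Finset V) := Finset.mem_singleton_self x
  set ξ : (↥(Λ \ {x}) → ℤˣ) → SpinConfig V := fun τ₂ => glue (Λ \ {x}) τ₂ (.fixed 1) with hξ
  set H : (↥(Λ \ {x}) → ℤˣ) → ℝ := fun τ₂ => ∑ y ∈ G.neighborFinset x, spinAt y (ξ τ₂) with hH
  have hterm : ∀ (τ₂ : ↥(Λ \ {x}) → ℤˣ) (τ₁ : ↥({x} : Finset V) → ℤˣ),
      isingWeight G {x} β 0 (.fixed (ξ τ₂)) τ₁ = Real.exp (β * ((((τ₁ ⟨x, hxmem⟩ : ℤˣ) : ℤ) : ℝ) * H τ₂)) ∧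
      F (glue {x} τ₁ (.fixed (ξ τ₂))) = F (ξ τ₂) ∧
      spinAt x (glue {x} τ₁ (.fixed (ξ τ₂))) = (((τ₁ ⟨x, hxmem⟩ : ℤˣ) : ℤ) : ℝ) := by
    intro τ₂ τ₁
    refine ⟨isingWeight_singleton G x β (ξ τ₂) τ₁, ?_, ?_⟩
    · rw [glue_singleton_eq_update, hF]
    · rw [glue_singleton_eq_update]
      simp [spinAt]
  refine ⟨?_, ?_⟩
  · rw [hplus, sum_isingWeight_fixed_eq_sum_sum G hsub 1 β 0 F]
    refine Finset.sum_congr rfl fun τ₂ _ => ?_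
    congr 1
    rw [Finset.sum_congr rfl fun τ₁ _ => by rw [(hterm τ₂ τ₁).1, (hterm τ₂ τ₁).2.1],
      sum_config_singleton]
    simp only [Units.val_one, Units.val_neg, Int.cast_one, Int.cast_neg, one_mul, neg_mul, mul_neg, Real.cosh_eq, hH]
    ring
  · rw [hplus, sum_isingWeight_fixed_eq_sum_sum G hsub 1 β 0 (fun σ => spinAt x σ * F σ)]
    refine Finset.sum_congr rfl fun τ₂ _ => ?_
    congr 1
    rw [Finset.sum_congr rfl fun τ₁ _ => by
        rw [(hterm τ₂ τ₁).1, (hterm τ₂ τ₁).2.1, (hterm τ₂ τ₁).2.2], sum_config_singleton]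
    simp only [Units.val_one, Units.val_neg, Int.cast_one, Int.cast_neg, one_mul, neg_mul, mul_neg, Real.sinh_eq, hH]
    ring

/-- **The DLR form of the lattice Laplacian of Ising correlations (exact odd-moment expansion).**
For the nearest-neighbour Ising model on a locally finite graph `G`, a finite volume `Λ ∋ x`, `+`
boundary condition, zero field, any `β` and any site `o ≠ x`, with `N` the neighbours of `x`,
`n = deg x`, `h_x = Σ_{y∈N}σ_y`, `t = tanh β`:
`Σ_{y∼x}⟨σ_oσ_y⟩⁺_Λ − n⟨σ_oσ_x⟩⁺_Λ = cosh^n β Σ_{T⊆N, #T odd} t^{#T−1}(1−t)(#T − (n−#T)t)·⟨σ_oσ_T/cosh(βh_x)⟩⁺_Λ`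
(two-step decomposition at `x`, Friedli–Velenik 2017 Lemma 6.7, + the finite high-temperature
expansion `Bethe.bethe_identity`). The moments on the right are Griffiths-nonnegative for `β ≥ 0`
(`Bethe.deleted_outer_gks_nonneg` after `two_step_at`). -/
theorem finiteVolume_laplacian_dlr : ∀ {V : Type*} [DecidableEq V] (G : SimpleGraph V) [G.LocallyFinite] (β : ℝ) {Λ : Finset V} {x o : V}, x ∈ Λ → o ≠ x → (∑ y ∈ G.neighborFinset x, isingExpect G Λ β 0 .plus (spinPair o y)) - (G.degree x : ℝ) * isingExpect G Λ β 0 .plus (spinPair o x) = Real.cosh β ^ G.degree x * ∑ T ∈ (G.neighborFinset x).powerset.filter (fun T => Odd #T), Real.tanh β ^ (#T - 1) * (1 - Real.tanh β) * ((#T : ℝ) - ((G.degree x : ℝ) - #T) * Real.tanh β) * isingExpect G Λ β 0 .plus (fun σ => spinAt o σ * spinProduct T σ / Real.cosh (β * ∑ y ∈ G.neighborFinset x, spinAt y σ)) := by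
  intro V _ G _ β Λ x o hx hox
  classical
  set N := G.neighborFinset x with hN
  have hdeg : G.degree x = #N := by rw [hN, SimpleGraph.card_neighborFinset_eq_degree]
  have hxN : ∀ y ∈ N, y ≠ x := fun y hy => ((SimpleGraph.mem_neighborFinset G x y).1 hy).ne'
  set Z := isingPartitionFunction G Λ β 0 .plus with hZdef
  have hZ : 0 < Z := isingPartitionFunction_pos G Λ β 0 .plus
  set ξ : (↥(Λ \ {x}) → ℤˣ) → SpinConfig V := fun τ₂ => glue (Λ \ {x}) τ₂ (.fixed 1) with hξ
  set E : (↥(Λ \ {x}) → ℤˣ) → ℝ := fun τ₂ =>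
    Real.exp (β * (∑ e ∈ edgesTouching G Λ \ edgesTouching G {x}, bondSpin (ξ τ₂) e +
      0 * ∑ z ∈ Λ \ {x}, spinAt z (ξ τ₂))) with hE
  -- measurability of the observables
  have hHm : Measurable fun σ : SpinConfig V => Real.cosh (β * ∑ y ∈ N, spinAt y σ) :=
    Real.continuous_cosh.measurable.comp
      ((Finset.measurable_sum N fun y _ => measurable_spinAt y).const_mul β)
  have hObs : ∀ T : Finset V, Measurable fun σ : SpinConfig V =>
      spinAt o σ * spinProduct T σ / Real.cosh (β * ∑ y ∈ N, spinAt y σ) := fun T =>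
    ((measurable_spinAt o).mul (measurable_spinProduct T)).div hHm
  -- the observables do not read `σ_x`
  have hHupd : ∀ (σ : SpinConfig V) (u : ℤˣ), (∑ y ∈ N, spinAt y (Function.update σ x u)) =
      ∑ y ∈ N, spinAt y σ := fun σ u =>
    Finset.sum_congr rfl fun y hy => by simp only [spinAt, Function.update_of_ne (hxN y hy)]
  -- numerators via the two-step decomposition (`N`, `ξ`, `E` unfold definitionally)
  have num_x : ∑ τ : Λ → ℤˣ, isingWeight G Λ β 0 .plus τ *
      (spinAt x (glue Λ τ .plus) * spinAt o (glue Λ τ .plus)) =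
      ∑ τ₂ : ↥(Λ \ {x}) → ℤˣ, E τ₂ * (spinAt o (ξ τ₂) *
        (2 * Real.sinh (β * ∑ y ∈ N, spinAt y (ξ τ₂)))) :=
    (two_step_at G (β := β) hx (F := spinAt o)
      (fun σ u => by simp only [spinAt, Function.update_of_ne hox])).2
  have num_y : ∀ y ∈ N, ∑ τ : Λ → ℤˣ, isingWeight G Λ β 0 .plus τ * spinPair o y (glue Λ τ .plus) =
      ∑ τ₂ : ↥(Λ \ {x}) → ℤˣ, E τ₂ * (spinPair o y (ξ τ₂) *
        (2 * Real.cosh (β * ∑ z ∈ N, spinAt z (ξ τ₂)))) :=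
    fun y hy => (two_step_at G (β := β) hx (F := spinPair o y) (fun σ u => by
      simp only [spinPair, spinAt, Function.update_of_ne hox, Function.update_of_ne (hxN y hy)])).1
  have num_T : ∀ T ∈ N.powerset, ∑ τ : Λ → ℤˣ, isingWeight G Λ β 0 .plus τ *
      (spinAt o (glue Λ τ .plus) * spinProduct T (glue Λ τ .plus) /
        Real.cosh (β * ∑ y ∈ N, spinAt y (glue Λ τ .plus))) =
      ∑ τ₂ : ↥(Λ \ {x}) → ℤˣ, E τ₂ * (spinAt o (ξ τ₂) * spinProduct T (ξ τ₂) /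
        Real.cosh (β * ∑ y ∈ N, spinAt y (ξ τ₂)) *
        (2 * Real.cosh (β * ∑ y ∈ N, spinAt y (ξ τ₂)))) := by
    intro T hT
    have hTN : T ⊆ N := Finset.mem_powerset.1 hT
    exact (two_step_at G (β := β) hx
      (F := fun σ => spinAt o σ * spinProduct T σ / Real.cosh (β * ∑ y ∈ N, spinAt y σ))
      (fun σ u => by
        have hT' : spinProduct T (Function.update σ x u) = spinProduct T σ :=
          Finset.prod_congr rfl fun y hy => by
            simp only [spinAt, Function.update_of_ne (hxN y (hTN hy))]
        have ho' : spinAt o (Function.update σ x u) = spinAt o σ := by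
          simp only [spinAt, Function.update_of_ne hox]
        simp only [hHupd, hT', ho'])).1
  -- the same numerators in the normal form of `bethe_identity`
  have num_x' : ∑ τ : Λ → ℤˣ, isingWeight G Λ β 0 .plus τ *
      (spinAt x (glue Λ τ .plus) * spinAt o (glue Λ τ .plus)) =
      2 * ∑ τ₂ : ↥(Λ \ {x}) → ℤˣ, E τ₂ * spinAt o (ξ τ₂) *
        Real.sinh (β * ∑ y ∈ N, spinAt y (ξ τ₂)) := by
    rw [num_x, Finset.mul_sum]
    exact Finset.sum_congr rfl fun τ₂ _ => by ring
  have num_y' : ∀ y ∈ N, ∑ τ : Λ → ℤˣ, isingWeight G Λ β 0 .plus τ * spinPair o y (glue Λ τ .plus) =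
      2 * ∑ τ₂ : ↥(Λ \ {x}) → ℤˣ, E τ₂ * spinAt o (ξ τ₂) * spinAt y (ξ τ₂) *
        Real.cosh (β * ∑ z ∈ N, spinAt z (ξ τ₂)) := by
    intro y hy
    rw [num_y y hy, Finset.mul_sum]
    exact Finset.sum_congr rfl fun τ₂ _ => by rw [spinPair]; ring
  have num_T' : ∀ T ∈ N.powerset, ∑ τ : Λ → ℤˣ, isingWeight G Λ β 0 .plus τ *
      (spinAt o (glue Λ τ .plus) * spinProduct T (glue Λ τ .plus) /
        Real.cosh (β * ∑ y ∈ N, spinAt y (glue Λ τ .plus))) =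
      2 * ∑ τ₂ : ↥(Λ \ {x}) → ℤˣ, E τ₂ * spinAt o (ξ τ₂) * ∏ y ∈ T, spinAt y (ξ τ₂) := by
    intro T hT
    rw [num_T T hT, Finset.mul_sum]
    refine Finset.sum_congr rfl fun τ₂ _ => ?_
    have hc : Real.cosh (β * ∑ y ∈ N, spinAt y (ξ τ₂)) ≠ 0 := (Real.cosh_pos _).ne'
    rw [spinProduct]
    field_simp
  -- the abstract identity for the outer system
  have hid := bethe_identity E (fun τ₂ => spinAt o (ξ τ₂)) (fun y τ₂ => spinAt y (ξ τ₂)) N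
    (fun y _ τ₂ => spinAt_eq_one_or_eq_neg_one y (ξ τ₂)) β
  -- the identity between NUMERATORS
  have key : (∑ y ∈ N, ∑ τ : Λ → ℤˣ, isingWeight G Λ β 0 .plus τ * spinPair o y (glue Λ τ .plus)) -
      (#N : ℝ) * ∑ τ : Λ → ℤˣ, isingWeight G Λ β 0 .plus τ *
        (spinAt x (glue Λ τ .plus) * spinAt o (glue Λ τ .plus)) =
      Real.cosh β ^ #N * ∑ T ∈ N.powerset.filter (fun T => Odd #T),
        Real.tanh β ^ (#T - 1) * (1 - Real.tanh β) * ((#T : ℝ) - ((#N : ℝ) - #T) * Real.tanh β) *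
          ∑ τ : Λ → ℤˣ, isingWeight G Λ β 0 .plus τ *
            (spinAt o (glue Λ τ .plus) * spinProduct T (glue Λ τ .plus) /
              Real.cosh (β * ∑ y ∈ N, spinAt y (glue Λ τ .plus))) := by
    rw [Finset.sum_congr rfl num_y', num_x', ← Finset.mul_sum, ← mul_assoc, mul_comm (#N : ℝ) 2,
      mul_assoc, ← mul_sub, hid, Finset.mul_sum, Finset.mul_sum, Finset.mul_sum]
    refine Finset.sum_congr rfl fun T hT => ?_
    rw [num_T' T (Finset.mem_of_mem_filter T hT)]
    ring
  -- divide by the partition function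
  have hpair : spinPair o x = fun σ => spinAt x σ * spinAt o σ := funext fun σ => mul_comm _ _
  have eX : isingExpect G Λ β 0 .plus (spinPair o x) =
      (∑ τ : Λ → ℤˣ, isingWeight G Λ β 0 .plus τ *
        (spinAt x (glue Λ τ .plus) * spinAt o (glue Λ τ .plus))) / Z := by
    rw [hpair, isingExpect_eq_sum_div G Λ 0 .plus β (f := fun σ => spinAt x σ * spinAt o σ)
      (show Measurable (fun σ => spinAt x σ * spinAt o σ) from
        (measurable_spinAt x).mul (measurable_spinAt o))]
  have eY : ∀ y ∈ N, isingExpect G Λ β 0 .plus (spinPair o y) =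
      (∑ τ : Λ → ℤˣ, isingWeight G Λ β 0 .plus τ * spinPair o y (glue Λ τ .plus)) / Z :=
    fun y _ => isingExpect_eq_sum_div G Λ 0 .plus β (measurable_spinPair o y)
  have eT : ∀ T ∈ N.powerset.filter (fun T => Odd #T), isingExpect G Λ β 0 .plus
      (fun σ => spinAt o σ * spinProduct T σ / Real.cosh (β * ∑ y ∈ N, spinAt y σ)) =
      (∑ τ : Λ → ℤˣ, isingWeight G Λ β 0 .plus τ *
        (spinAt o (glue Λ τ .plus) * spinProduct T (glue Λ τ .plus) /
          Real.cosh (β * ∑ y ∈ N, spinAt y (glue Λ τ .plus)))) / Z :=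
    fun T _ => isingExpect_eq_sum_div G Λ 0 .plus β (hObs T)
  rw [eX, Finset.sum_congr rfl eY, hdeg, ← Finset.sum_div, ← mul_div_assoc, ← sub_div, key,
    mul_div_assoc, Finset.sum_div]
  congr 1
  refine Finset.sum_congr rfl fun T hT => ?_
  rw [eT T hT, mul_div_assoc]

end Summit.CriticalPhenomena.Ising3DConformalLimit.Theorems.PerfectScreening.Bethe

end
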